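import Summits.QuantumFields.YangMills.Theorems.BalabanUVNodesN15DefectKernelVectorPieceDeriv
import Summits.QuantumFields.YangMills.Theorems.BalabanUVNodesN15DefectKernelLapHk
import HarnessLib

/-!
# Route «BalabanUVNodes» (K4 «SpineRates»), node N15 = NE2, -a lane, part 22: THE FOURTH (3.42) ENTRY OF THE VECTOR SINGLE-SCALE PIECE —
# `𝔇((Δ′−∂′∂′*)G′, (Δ−∂∂*)G)` = `𝔇(F′C′K′, FCK)` with `F = (Δ−∂∂*)H_k` (parts 18–21) ASSEMBLED in binder (a)'s format (parts 9∕12's mechanism), on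
# any carrier and on the concrete unit-torus carrier

Cell `pub-ymgap`, seat `pub-ymgap-dag-n15-a` (KNIT-BY-NAME, generation g4; HUMAN RULING D-0062; chair R424 venue; `bears_on: R4∕N15`).  Filed
`--supports stmt-QuantumFields-19351` (helper).  THEOREMS ONLY; imports BY NAME part 12 (`…VectorPieceDeriv`: the three-factor assembly pattern and through it
parts 1∕3∕4∕8∕9, `T4EtaRateDefect.idef_comp_majorant`, `B9SectDWeightedNeumann`, `T4Cov2156Rate.cov2156_pair_torus`∕`cov2156_rate_torus_king`), part 21
(`lapker_bounds`: uniform decay `c_F e^{−δ_F|B(x)−y|_T}` and paired rate `(C_F∕n)e^{−δ_F|B(x′)−y|_T}` of `F`'s entries; `hasMaj_idef_lapHk`), `B6UnitTorusCarrier`.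
Nothing in the tree is modified; nothing printed is a hypothesis.

THE POINT (N15-DOSSIER §6: «entry 3 `Δ_UG′` (second differences) has NO printed∕tree input — located, not claimed»; part 17: the readout is landed MODULO
this entry).  With parts 18–21 the fourth entry needs no second-difference estimate: `(Δ−∂∂*)G = F·C^{(k)}·K` with `F = (Δ−∂∂*)H_k = Q_kᴴ(n^{d+1}Δ_k)`, whose
entries decay and converge (two-lattice rate `η = 1∕n`) like `H_k`'s BY NAME of the (1.66) lineage.  THIS FILE repeats part 12's assembly with the left factor
`D = ∂_νH_k` replaced by `F`: §1 **`hasMaj_idef_vectorPieceLap`** (any [B6] carrier, site assignments, King's pairing, operators by entries, the two unit-torus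
dominances — the H∕F-dominance at rate `min(δ_F, κ₁₆₃∕(d+1))` —, rate window): `𝔇(F′C′K′, FCK)` has the majorant
`[nΩ c_F c_r (nΩ B₀ c_r (n_η w R_H) + nΩ R_C c_r (n_η w c₀)) + nΩ (C_F∕L^k) c_r (nΩ B₀ c_r (n_η w c₀))]·e^{−ρd}`; §2 **`hasMaj_idef_vectorPieceLap_unitTorus`** (part
14's pattern: every geometric binder discharged on `unitTorusGeo L k M` with EQUALITY dominances and volume-independent `c_r`).  Part 23 fixes the Riemann weight,
pulls the single rate factor `(L^k)⁻¹` out, and plugs the result into part 17's binder `T3` — the four-entry readout becomes unconditional.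

HONEST FRAMING ∕ LIMITS.  `U = 1` linear theory on finite tori, `d + 1 ≥ 2`, one single-scale piece in King's (4.42) shape; the Laplacian is the gauge-fixed
`Δ − ∂∂*` of [B5] Sect. D (part 18), NOT the covariant `Δ_U` at `U ≠ 1` (NE2⁺ proper NOT PRINTED ∕ not proved); constants existential (dimension∕`L` only);
count-neutral (typed 28∕28 · discharged unchanged); NOT a discharge of N15; one finite T⁴ at fixed ε — NOT infinite volume, NOT OS on ℝ⁴, NOT a mass gap, NOT Clay.
-/

noncomputable section

open scoped BigOperators
open Finset

namespace Summit.QuantumFields.YangMills.BalabanUVNodes.N15.VectorPiece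

open Literature.MathematicalPhysics.QuantumFieldTheory.Balaban1983to89
open Literature.MathematicalPhysics.QuantumFieldTheory.Balaban1983to89.B11SectG (BlockNorm HasMaj RowSum)
open Literature.MathematicalPhysics.QuantumFieldTheory.Balaban1983to89.T4EtaRateDefect (idef idef_comp_majorant slowWeight_const)
open Literature.MathematicalPhysics.QuantumFieldTheory.Balaban1983to89.T4EtaRateCoeffDefect (pull fibre mem_fibre)
open Literature.MathematicalPhysics.QuantumFieldTheory.Balaban1983to89.B9SectDWeightedNeumann (WRow wrow_of_exp hasMaj_comp_wrow)
open Literature.MathematicalPhysics.QuantumFieldTheory.Balaban1983to89.B6RandomWalk (Triangle254)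
open Literature.MathematicalPhysics.QuantumFieldTheory.Balaban1983to89.B4TorusKernel (periodConst)
open Literature.MathematicalPhysics.QuantumFieldTheory.Balaban1983to89.B5Prop11Plancherel (Tor fine)
open Literature.MathematicalPhysics.QuantumFieldTheory.Balaban1983to89.B5Block118 (bpt)
open Literature.MathematicalPhysics.QuantumFieldTheory.Balaban1983to89.B5Blocks16 (bpt_val bpt_bijective)
open Literature.MathematicalPhysics.QuantumFieldTheory.Balaban1983to89.B5Hk163Strip (kappa163 kappa163_pos)
open Literature.MathematicalPhysics.QuantumFieldTheory.Balaban1983to89.B5Hk163Decay (MG163)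
open Literature.MathematicalPhysics.QuantumFieldTheory.Balaban1983to89.B5Hk163Torus (HkOp norm_HkOp_le)
open Literature.MathematicalPhysics.QuantumFieldTheory.Balaban1983to89.B5Hk163RDiv (DstarD)
open Literature.MathematicalPhysics.QuantumFieldTheory.Balaban1983to89.B5Hk163TorusHolderDecay (MD163)
open Literature.MathematicalPhysics.QuantumFieldTheory.Balaban1983to89.T4Hk163StripRate (CGe)
open Literature.MathematicalPhysics.QuantumFieldTheory.Balaban1983to89.B6LowerBound2153Torus (toT rep toT_rep rep_mem_pbox)
open Literature.MathematicalPhysics.QuantumFieldTheory.Balaban1983to89.B6Lemma24Torus (pbox)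
open Literature.MathematicalPhysics.QuantumFieldTheory.Balaban1983to89.B6BondEliminationTorus (pdist)
open Literature.MathematicalPhysics.QuantumFieldTheory.Balaban1983to89.B6Cov2156Torus (deltaPol bondReductionT one_le_M)
open Literature.MathematicalPhysics.QuantumFieldTheory.Balaban1983to89.T4Cov2156Rate (cov2156_pair_torus cov2156_rate_torus_king
  bondDist_nonneg)
open Literature.MathematicalPhysics.QuantumFieldTheory.Balaban1983to89.B6UnitTorusCarrier (unitTorusGeo triangle254_unitTorusGeo
  unitTorusGeo_dist_nonneg unitTorusGeo_dist_symm rowSum_unitTorusGeo card_fibre_unitBond card_fibre_fineBond pdist_rep_rep)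
open Literature.MathematicalPhysics.QuantumFieldTheory.King1986 (exp_decay_mono)
open Literature.MathematicalPhysics.QuantumFieldTheory.King1986.Torus (blockOf val_blockOf tdistT tdistT_symm tdistT_nonneg blockOf_over)
open Summit.QuantumFields.YangMills.BalabanUVNodes.N15.DefectKernel (norm_HkOp_le_tdistT norm_HkOp_kingPair_sub_le card_fibre_bondPair
  king_weight_balance hasMaj_ofBlocks_of_entry_le hasMaj_idef_transpose_of_pairedRate hasMaj_idef_id_id_of_rate)

variable {d : ℕ}

/-! ## §1 The fourth entry of the piece on any carrier -/

section Piece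

/-- **THE FOURTH (3.42) ENTRY OF THE VECTOR SINGLE-SCALE PIECE IN BINDER (a)'s FORMAT** — part 12's assembly with the left factor `F = (Δ−∂∂*)H_k` (read off by
entries: binders `hF`, `hF′`; its uniform decay and paired rate are part 21's `lapker_bounds`, constants `c_F, C_F, δ_F` inside the existential): for every unit torus
`Π ℤ∕M_ν` with `L ∣ M_ν`, all `k`, `m ≥ 1`, any carrier and site assignments with the H∕F-dominance `δ·d(blkΩ b, blkη i) ≤ min(δ_F, κ₁₆₃∕(d+1))·|b − B(i)|_T`, the
C-dominance and the rate window, `𝔇(F′C′K′, FCK)` through (pull, pull) has the displayed block majorant times `e^{−ρd(y,y′)}`.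
[cite: Balaban1985BackgroundPropagators, (3.42) p.397 (fourth entry, shape); King1986, (4.42)–(4.43) p.675 (mechanism); Balaban1984PropagatorsI, (1.18) p.20, (1.63) p.28, (1.65) p.29; Balaban1984PropagatorsII, (2.156) p.250] -/
theorem hasMaj_idef_vectorPieceLap (hd : 1 ≤ d) {L : ℕ} [NeZero L] (hL : 1 ≤ L) :
    ∃ B₀ C₁ δ' cF CF δF : ℝ, 0 < B₀ ∧ 0 < C₁ ∧ 0 < δ' ∧ 0 < cF ∧ 0 < CF ∧ 0 < δF ∧
      ∀ (M : Fin (d + 1) → ℕ) [∀ μ, NeZero (M μ)] (_ : ∀ i, L ∣ M i) (k m : ℕ) (_ : 1 ≤ m)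
      -- the carrier and the site assignments
      {g : B6.Geometry} [DecidableEq g.Site] (_ : Triangle254 g) (_ : ∀ y y' : g.Site, 0 ≤ g.dist y y')
      (_ : ∀ y y' : g.Site, g.dist y y' = g.dist y' y) {σr cr : ℝ} (_ : 0 ≤ σr) (_ : RowSum g σr cr)
      (blkΩ : Tor M × Fin (d + 1) → g.Site) {nΩ : ℕ} (_ : ∀ y', (fibre blkΩ y').card ≤ nΩ)
      (blkη : Tor (fine (L ^ k) M) × Fin (d + 1) → g.Site) {nη : ℕ} (_ : ∀ y', (fibre blkη y').card ≤ nη)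
      (pr : Tor (fine (L ^ m * L ^ k) M) → Tor (fine (L ^ k) M)) (_ : ∀ x' μ, (pr x' μ).val = (x' μ).val / L ^ m)
      (prV : Tor (fine (L ^ m * L ^ k) M) × Fin (d + 1) → Tor (fine (L ^ k) M) × Fin (d + 1))
      (_ : ∀ i, prV i = (pr i.1, i.2))
      -- Bałaban's operators, read off by their entries
      (H : (Tor M × Fin (d + 1) → ℝ) →ₗ[ℝ] (Tor (fine (L ^ k) M) × Fin (d + 1) → ℝ))
      (_ : ∀ b i, H (Pi.single b 1) i = (HkOp (L ^ k) M i b).re)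
      (H' : (Tor M × Fin (d + 1) → ℝ) →ₗ[ℝ] (Tor (fine (L ^ m * L ^ k) M) × Fin (d + 1) → ℝ))
      (_ : ∀ b i, H' (Pi.single b 1) i = (HkOp (L ^ m * L ^ k) M i b).re)
      (F : (Tor M × Fin (d + 1) → ℝ) →ₗ[ℝ] (Tor (fine (L ^ k) M) × Fin (d + 1) → ℝ))
      (_ : ∀ b i, F (Pi.single b 1) i = ((DstarD (L ^ k) M * HkOp (L ^ k) M) i b).re)
      (F' : (Tor M × Fin (d + 1) → ℝ) →ₗ[ℝ] (Tor (fine (L ^ m * L ^ k) M) × Fin (d + 1) → ℝ))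
      (_ : ∀ b i, F' (Pi.single b 1) i = ((DstarD (L ^ m * L ^ k) M * HkOp (L ^ m * L ^ k) M) i b).re)
      {w : ℝ} (_ : 0 ≤ w) (K : (Tor (fine (L ^ k) M) × Fin (d + 1) → ℝ) →ₗ[ℝ] (Tor M × Fin (d + 1) → ℝ))
      (_ : ∀ i b, K (Pi.single i 1) b = w * H (Pi.single b 1) i)
      (K' : (Tor (fine (L ^ m * L ^ k) M) × Fin (d + 1) → ℝ) →ₗ[ℝ] (Tor M × Fin (d + 1) → ℝ))
      (_ : ∀ i' b, K' (Pi.single i' 1) b = w / ((L : ℝ) ^ m) ^ (d + 1) * H' (Pi.single b 1) i')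
      (e : Tor M × Fin (d + 1) → B4.Idx (pbox M) (d + 1))
      (C : (Tor M × Fin (d + 1) → ℝ) →ₗ[ℝ] (Tor M × Fin (d + 1) → ℝ))
      (_ : ∀ b b', C (Pi.single b' 1) b = (bondReductionT L M (deltaPol M (L ^ k))).cov (e b) (e b'))
      (C' : (Tor M × Fin (d + 1) → ℝ) →ₗ[ℝ] (Tor M × Fin (d + 1) → ℝ))
      (_ : ∀ b b', C' (Pi.single b' 1) b = (bondReductionT L M (deltaPol M (L ^ (k + m)))).cov (e b) (e b'))
      -- the two unit-torus dominances (the consumer's reading of its site assignments)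
      {δ : ℝ} (_ : ∀ (b : Tor M × Fin (d + 1)) (i : Tor (fine (L ^ k) M) × Fin (d + 1)),
        δ * g.dist (blkΩ b) (blkη i) ≤ min δF (kappa163 (d + 1) / (d + 1)) * tdistT M b.1 (blockOf (L ^ k) M i.1))
      {δC : ℝ} (_ : ∀ b b' : Tor M × Fin (d + 1),
        δC * g.dist (blkΩ b) (blkΩ b') ≤ δ' * pdist M (one_le_M M) ((e b).1 : Fin (d + 1) → ℤ) ((e b').1 : Fin (d + 1) → ℤ))
      -- the rate window
      {ρ : ℝ} (_ : 0 ≤ ρ) (_ : ρ + σr ≤ δ) (_ : ρ + σr ≤ δC),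
      HasMaj (BlockNorm.ofBlocks g blkη) (BlockNorm.ofBlocks g (blkη ∘ prV))
        (idef (pull prV) (pull prV) (F' ∘ₗ (C' ∘ₗ K')) (F ∘ₗ (C ∘ₗ K)))
        (fun y y' =>
          (nΩ * cF * cr *
              (nΩ * B₀ * cr *
                  (nη * w * ((CGe (d + 1) + (d + 1) * MD163 (d + 1)) * periodConst (kappa163 (d + 1)) d / ((L ^ k : ℕ) : ℝ)))
                + nΩ * (C₁ * ((L : ℝ) ^ k)⁻¹) * cr * (nη * w * (MG163 (d + 1) * periodConst (kappa163 (d + 1)) d)))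
            + nΩ * (CF / ((L ^ k : ℕ) : ℝ)) * cr *
              (nΩ * B₀ * cr * (nη * w * (MG163 (d + 1) * periodConst (kappa163 (d + 1)) d)))) *
          Real.exp (-(ρ * g.dist y y'))) := by
  have hd1 : 2 ≤ d + 1 := by omega
  obtain ⟨B₀, δ₀, hB₀, hδ₀, HP⟩ := cov2156_pair_torus (d := d + 1) hd1 hL
  obtain ⟨C₁, δ₁, hC₁, hδ₁, HR⟩ := cov2156_rate_torus_king (d := d + 1) hd1 hL
  obtain ⟨cF, CF, δF, hcF, hCF, hδF, HF⟩ := lapker_bounds (d := d)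
  refine ⟨B₀, C₁, min δ₀ δ₁, cF, CF, δF, hB₀, hC₁, lt_min hδ₀ hδ₁, hcF, hCF, hδF, ?_⟩
  intro M _ hLM k m hm g _ htri hdist hsymm σr cr hσr hrow blkΩ nΩ hnΩ blkη nη hnη pr hpr prV hprV H hH H' hH' D hD D' hD'
    w hw0 K hK K' hK' e C hC C' hC' δ hdomHF δC hdomC ρ hρ hρ₁ hρ₂
  obtain ⟨HFdec', -⟩ := HF M (L ^ m * L ^ k)
  obtain ⟨-, HFrate⟩ := HF M (L ^ k)
  -- the H-dominance (rate `κ₁₆₃∕(d+1)`) and the F-dominance (rate `δ_F`) follow from the one at the minimum rate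
  have hdomH : ∀ (b : Tor M × Fin (d + 1)) (i : Tor (fine (L ^ k) M) × Fin (d + 1)),
      δ * g.dist (blkΩ b) (blkη i) ≤ kappa163 (d + 1) / (d + 1) * tdistT M b.1 (blockOf (L ^ k) M i.1) := fun b i =>
    (hdomHF b i).trans (mul_le_mul_of_nonneg_right (min_le_right _ _) (tdistT_nonneg M _ _))
  have hdomF : ∀ (b : Tor M × Fin (d + 1)) (i : Tor (fine (L ^ k) M) × Fin (d + 1)),
      δ * g.dist (blkΩ b) (blkη i) ≤ δF * tdistT M b.1 (blockOf (L ^ k) M i.1) := fun b i =>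
    (hdomHF b i).trans (mul_le_mul_of_nonneg_right (min_le_left _ _) (tdistT_nonneg M _ _))
  -- names for the constants
  set c₀ : ℝ := MG163 (d + 1) * periodConst (kappa163 (d + 1)) d with hc₀def
  set RH : ℝ := (CGe (d + 1) + (d + 1) * MD163 (d + 1)) * periodConst (kappa163 (d + 1)) d / ((L ^ k : ℕ) : ℝ) with hRHdef
  set RC : ℝ := C₁ * ((L : ℝ) ^ k)⁻¹ with hRCdef
  set cD : ℝ := cF with hcDdef
  set RD : ℝ := CF / ((L ^ k : ℕ) : ℝ) with hRDdef
  have hcD : 0 ≤ cD := hcF.le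
  have hRD0 : 0 ≤ RD := div_nonneg hCF.le (Nat.cast_nonneg _)
  have hc₀ : 0 ≤ c₀ := by
    -- `c₀ = MG163·periodConst ≥ 0`: read off `norm_HkOp_le_tdistT` at any entry
    have h1 := (norm_nonneg _).trans (norm_HkOp_le_tdistT (L ^ k) M 0 0 (0 : Tor (fine (L ^ k) M)) (0 : Tor M))
    have hE := Real.exp_pos (-(kappa163 (d + 1) / (d + 1) * tdistT M (blockOf (L ^ k) M 0) 0))
    nlinarith
  have hRH0 : 0 ≤ RH := by
    -- `R_H ≥ 0`: read off part 8's rate theorem at any entry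
    have h1 := (norm_nonneg _).trans
      (norm_HkOp_kingPair_sub_le (L ^ m) (L ^ k) M pr hpr 0 0 (0 : Tor (fine (L ^ m * L ^ k) M)) (0 : Tor M))
    have hE := Real.exp_pos (-(kappa163 (d + 1) / (d + 1) * tdistT M (blockOf (L ^ m * L ^ k) M 0) 0))
    nlinarith
  have hRC0 : 0 ≤ RC := mul_nonneg hC₁.le (inv_nonneg.mpr (pow_nonneg (Nat.cast_nonneg _) _))
  have hnηw : 0 ≤ (nη : ℝ) * w := mul_nonneg (Nat.cast_nonneg _) hw0
  -- the H-legs: uniform decay (Theorem-3.3's role) in the carrier, from §1 and the H-dominance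
  have hdecH : ∀ (b : Tor M × Fin (d + 1)) (i : Tor (fine (L ^ k) M) × Fin (d + 1)),
      |H (Pi.single b 1) i| ≤ c₀ * Real.exp (-(δ * g.dist (blkΩ b) (blkη i))) := fun b i => by
    rw [hH]
    refine (Complex.abs_re_le_norm _).trans ((norm_HkOp_le_tdistT (L ^ k) M i.2 b.2 i.1 b.1).trans ?_)
    refine mul_le_mul_of_nonneg_left (Real.exp_le_exp.mpr ?_) hc₀
    have := hdomH b i
    rw [tdistT_symm] at this
    linarith
  have hdecH' : ∀ (b : Tor M × Fin (d + 1)) (i' : Tor (fine (L ^ m * L ^ k) M) × Fin (d + 1)),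
      |H' (Pi.single b 1) i'| ≤ c₀ * Real.exp (-(δ * g.dist (blkΩ b) (blkη (prV i')))) := fun b i' => by
    rw [hH']
    refine (Complex.abs_re_le_norm _).trans ((norm_HkOp_le_tdistT (L ^ m * L ^ k) M i'.2 b.2 i'.1 b.1).trans ?_)
    refine mul_le_mul_of_nonneg_left (Real.exp_le_exp.mpr ?_) hc₀
    have h1 := hdomH b (prV i')
    simp only [hprV] at h1
    rw [tdistT_symm, ← blockOf_over M (pr i'.1) i'.1 (hpr i'.1)] at h1
    simp only [hprV]
    linarith
  -- the F-leg: uniform decay of the fine Laplacian factor (part 21 `lapker_bounds`), in the carrier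
  have hdecD' : ∀ (b : Tor M × Fin (d + 1)) (i' : Tor (fine (L ^ m * L ^ k) M) × Fin (d + 1)),
      |D' (Pi.single b 1) i'| ≤ cD * Real.exp (-(δ * g.dist (blkΩ b) (blkη (prV i')))) := fun b i' => by
    rw [hD']
    refine (HFdec' i'.1 i'.2 b.1 b.2).trans ?_
    refine mul_le_mul_of_nonneg_left (Real.exp_le_exp.mpr ?_) hcD
    have h1 := hdomF b (prV i')
    simp only [hprV] at h1
    rw [tdistT_symm, ← blockOf_over M (pr i'.1) i'.1 (hpr i'.1)] at h1
    simp only [hprV]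
    linarith
  -- (i) the undifferenced COARSE adjoint factor `K`: `a_K·e^{−ρd}`, `a_K = n_η w c₀`
  have hδρ : ρ ≤ δ := by linarith
  have hKmaj : HasMaj (BlockNorm.ofBlocks g blkη) (BlockNorm.ofBlocks g blkΩ) K
      (fun y y' => nη * w * c₀ * Real.exp (-((ρ + 0) * g.dist y y'))) := by
    have key := hasMaj_ofBlocks_of_entry_le blkη blkΩ (T := K)
      (κ := fun y y' => w * c₀ * Real.exp (-(ρ * g.dist y y')))
      (fun _ _ => mul_nonneg (mul_nonneg hw0 hc₀) (Real.exp_nonneg _)) hnη fun b i => by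
        rw [hK, abs_mul, abs_of_nonneg hw0, mul_assoc]
        refine mul_le_mul_of_nonneg_left ((hdecH b i).trans ?_) hw0
        rw [hsymm]
        exact exp_decay_mono hc₀ hδρ (hdist _ _)
    refine key.mono fun y y' => le_of_eq ?_
    rw [add_zero]; ring
  have hKmaj' : HasMaj (BlockNorm.ofBlocks g blkη) (BlockNorm.ofBlocks g blkΩ) K
      (fun y y' => nη * w * c₀ * Real.exp (-(ρ * g.dist y y'))) := by
    simpa only [add_zero] using hKmaj
  -- (ii) the DEFECT of the adjoint factor (part 4's transpose mechanism + part 8's paired rate): `ε_K·e^{−ρd}·1`, `ε_K = n_η w R_H`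
  have hw' : 0 ≤ w / ((L : ℝ) ^ m) ^ (d + 1) := div_nonneg hw0 (pow_nonneg (pow_nonneg (Nat.cast_nonneg _) _) _)
  have hbal : ∀ i : Tor (fine (L ^ k) M) × Fin (d + 1), w / ((L : ℝ) ^ m) ^ (d + 1) * ((fibre prV i).card : ℝ) = w := by
    rintro ⟨x, μ⟩
    rw [card_fibre_bondPair pr prV hprV x μ]
    exact king_weight_balance L k m M pr hpr w x
  have hDK : HasMaj (BlockNorm.ofBlocks g blkη) (BlockNorm.ofBlocks g blkΩ) (idef (pull prV) LinearMap.id K' K)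
      (fun y y' => nη * w * RH * Real.exp (-(ρ * g.dist y y')) * (fun _ : g.Site => (1 : ℝ)) y') := by
    have key := hasMaj_idef_transpose_of_pairedRate blkη blkΩ hnη prV hw0 hw' hK hK' hbal
      (κ := fun y y' => RH * Real.exp (-(ρ * g.dist y y'))) (fun _ _ => mul_nonneg hRH0 (Real.exp_nonneg _))
      fun b i' => by
        have h1 := hdomH b (prV i')
        simp only [hprV] at h1 ⊢
        rw [tdistT_symm, ← blockOf_over M (pr i'.1) i'.1 (hpr i'.1)] at h1
        rw [hH', hH, ← Complex.sub_re]
        refine (Complex.abs_re_le_norm _).trans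
          ((norm_HkOp_kingPair_sub_le (L ^ m) (L ^ k) M pr hpr i'.2 b.2 i'.1 b.1).trans ?_)
        refine mul_le_mul_of_nonneg_left (Real.exp_le_exp.mpr ?_) hRH0
        have h2 : ρ * g.dist (blkΩ b) (blkη (pr i'.1, i'.2)) ≤ δ * g.dist (blkΩ b) (blkη (pr i'.1, i'.2)) :=
          mul_le_mul_of_nonneg_right hδρ (hdist _ _)
        linarith
    refine key.mono fun y y' => le_of_eq ?_
    ring
  -- (iii) the DEFECT of the covariance ((2.156) rate, identity pairing): `N_C·1`, `N_C = nΩ R_C e^{−δ_C d}`, `‖N_C‖_ρ ≤ nΩ R_C c_r`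
  have hDC : HasMaj (BlockNorm.ofBlocks g blkΩ) (BlockNorm.ofBlocks g blkΩ) (idef LinearMap.id LinearMap.id C' C)
      (fun y y' => nΩ * RC * Real.exp (-(δC * g.dist y y')) * (fun _ : g.Site => (1 : ℝ)) y') := by
    have key := hasMaj_idef_id_id_of_rate blkΩ hnΩ C' C (t := fun b b' =>
        pdist M (one_le_M M) ((e b).1 : Fin (d + 1) → ℤ) ((e b').1 : Fin (d + 1) → ℤ)) hRC0 hdomC fun b b' => by
      rw [hC', hC]
      exact (HR M hLM k m (e b) (e b')).trans
        (exp_decay_mono hRC0 (min_le_right _ _) (bondDist_nonneg (one_le_M M) _ _))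
    exact key.mono fun y y' => le_of_eq (by rw [mul_one])
  have hNC_wrow : WRow g ρ (fun y y' => nΩ * RC * Real.exp (-(δC * g.dist y y'))) (nΩ * RC * cr) :=
    wrow_of_exp hdist hrow (mul_nonneg (Nat.cast_nonneg _) hRC0) hρ₂
  -- (iv) the undifferenced covariances `C`, `C′`: `N₀ = nΩ B₀ e^{−δ_C d}`, `‖N₀‖_ρ ≤ nΩ B₀ c_r`
  have hCov : ∀ {kk : ℕ} {T : (Tor M × Fin (d + 1) → ℝ) →ₗ[ℝ] (Tor M × Fin (d + 1) → ℝ)},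
      (∀ b b', T (Pi.single b' 1) b = (bondReductionT L M (deltaPol M (L ^ kk))).cov (e b) (e b')) →
      HasMaj (BlockNorm.ofBlocks g blkΩ) (BlockNorm.ofBlocks g blkΩ) T
        (fun y y' => nΩ * (B₀ * Real.exp (-(δC * g.dist y y')))) := by
    intro kk T hT
    refine hasMaj_ofBlocks_of_entry_le blkΩ blkΩ (κ := fun y y' => B₀ * Real.exp (-(δC * g.dist y y')))
      (fun _ _ => mul_nonneg hB₀.le (Real.exp_nonneg _)) hnΩ fun b b' => ?_
    rw [hT]
    refine ((HP M hLM kk (e b) (e b')).1).trans ?_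
    refine (exp_decay_mono hB₀.le (min_le_left δ₀ δ₁) (bondDist_nonneg (one_le_M M) _ _)).trans ?_
    exact mul_le_mul_of_nonneg_left (Real.exp_le_exp.mpr (by linarith [hdomC b b'])) hB₀.le
  have hCmaj := hCov (kk := k) (T := C) hC
  have hC'maj := hCov (kk := k + m) (T := C') hC'
  have hN₀ : ∀ y y' : g.Site, 0 ≤ nΩ * (B₀ * Real.exp (-(δC * g.dist y y'))) := fun _ _ =>
    mul_nonneg (Nat.cast_nonneg _) (mul_nonneg hB₀.le (Real.exp_nonneg _))
  have hm₀ : WRow g ρ (fun y y' => nΩ * (B₀ * Real.exp (-(δC * g.dist y y')))) (nΩ * B₀ * cr) := by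
    have h := wrow_of_exp (ρ := ρ) (θ := nΩ * B₀) (δ := δC) hdist hrow (mul_nonneg (Nat.cast_nonneg _) hB₀.le) hρ₂
    exact h.mono fun y y' => le_of_eq (by ring)
  -- STEP 1: `𝔇(C′K′, CK) ≤ (m₀ ε_K + nΩ R_C c_r a_K)·e^{−ρd}`
  have step1 := idef_comp_majorant (b₁ := BlockNorm.ofBlocks g blkη) (b₂ := BlockNorm.ofBlocks g blkΩ)
    (b₂' := BlockNorm.ofBlocks g blkΩ) (b₃' := BlockNorm.ofBlocks g blkΩ)
    (τ₁ := pull prV) (τ₂ := LinearMap.id) (τ₃ := LinearMap.id) (T₁' := C') (T₂' := K') (T₁ := C) (T₂ := K)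
    (w := fun _ => (1 : ℝ)) (σ := 0) (C := 1)
    htri hρ (fun _ => zero_le_one) (slowWeight_const 1) zero_le_one (mul_nonneg hnηw hRH0)
    (mul_nonneg hnηw hc₀) hN₀ hm₀ (fun y y' => mul_nonneg (mul_nonneg (Nat.cast_nonneg _) hRC0) (Real.exp_nonneg _))
    hNC_wrow hC'maj hDK hDC hKmaj
  -- (v) the undifferenced FINE factor `D′`: `nΩ c_D e^{−δ d}`, `‖·‖_ρ ≤ nΩ c_D c_r`
  have hH'maj : HasMaj (BlockNorm.ofBlocks g blkΩ) (BlockNorm.ofBlocks g (blkη ∘ prV)) D'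
      (fun y y' => nΩ * (cD * Real.exp (-(δ * g.dist y y')))) :=
    hasMaj_ofBlocks_of_entry_le blkΩ (blkη ∘ prV) (T := D') (κ := fun y y' => cD * Real.exp (-(δ * g.dist y y')))
      (fun _ _ => mul_nonneg hcD (Real.exp_nonneg _)) hnΩ fun i' b => by
        rw [Function.comp_apply, hsymm]
        exact hdecD' b i'
  have hH'wrow : WRow g ρ (fun y y' => nΩ * (cD * Real.exp (-(δ * g.dist y y')))) (nΩ * cD * cr) := by
    have h := wrow_of_exp (ρ := ρ) (θ := nΩ * cD) (δ := δ) hdist hrow (mul_nonneg (Nat.cast_nonneg _) hcD) hρ₁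
    exact h.mono fun y y' => le_of_eq (by ring)
  -- (vi) the DEFECT of `F` (part 21): `nΩ (C_F∕L^k) e^{−δ d}·1`, `‖·‖_ρ ≤ nΩ (C_F∕L^k) c_r`
  have hDH : HasMaj (BlockNorm.ofBlocks g blkΩ) (BlockNorm.ofBlocks g (blkη ∘ prV)) (idef LinearMap.id (pull prV) D' D)
      (fun y y' => nΩ * (RD * Real.exp (-(δ * g.dist y y'))) * (fun _ : g.Site => (1 : ℝ)) y') := by
    have key := hasMaj_idef_lapHk (L ^ k) M (L ^ m) blkΩ (blkη ∘ prV) hnΩ pr prV hprV D hD D' hD' hCF.le (HFrate (L ^ m) pr hpr)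
      (δ := δ) fun i' b => by
        have h1 := hdomF b (prV i')
        simp only [hprV] at h1
        rw [tdistT_symm, ← blockOf_over M (pr i'.1) i'.1 (hpr i'.1)] at h1
        rw [Function.comp_apply, hsymm]
        simp only [hprV]
        exact h1
    exact key.mono fun y y' => le_of_eq (by rw [hRDdef]; ring)
  have hDH_wrow : WRow g ρ (fun y y' => nΩ * (RD * Real.exp (-(δ * g.dist y y')))) (nΩ * RD * cr) := by
    have h := wrow_of_exp (ρ := ρ) (θ := nΩ * RD) (δ := δ) hdist hrow (mul_nonneg (Nat.cast_nonneg _) hRD0) hρ₁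
    exact h.mono fun y y' => le_of_eq (by ring)
  -- (vii) the undifferenced COARSE product `C∘K`: `1·m₀·a_K·e^{−ρd}`
  have hCK : HasMaj (BlockNorm.ofBlocks g blkη) (BlockNorm.ofBlocks g blkΩ) (C ∘ₗ K)
      (fun y y' => (BlockNorm.ofBlocks g blkΩ).κ * (nΩ * B₀ * cr) * (nη * w * c₀) * Real.exp (-((ρ + 0) * g.dist y y'))) := by
    have h := hasMaj_comp_wrow htri hρ (mul_nonneg hnηw hc₀) hN₀ hm₀ hCmaj hKmaj'
    simpa only [add_zero] using h
  have hκ : (BlockNorm.ofBlocks g blkΩ).κ = 1 := rfl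
  have hcr0 : 0 ≤ cr := le_trans (Finset.sum_nonneg fun _ _ => (Real.exp_pos _).le) (hrow (blkΩ (0, 0)))
  have hεCK : 0 ≤ (BlockNorm.ofBlocks g blkΩ).κ * (nΩ * B₀ * cr) * (nη * w * RH)
      + (BlockNorm.ofBlocks g blkΩ).κ * (nΩ * RC * cr) * (nη * w * c₀) * 1 := by
    rw [hκ]
    have := mul_nonneg hnηw hRH0
    have := mul_nonneg hnηw hc₀
    have := hB₀.le
    positivity
  have haCK : 0 ≤ (BlockNorm.ofBlocks g blkΩ).κ * (nΩ * B₀ * cr) * (nη * w * c₀) := by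
    rw [hκ]
    have := mul_nonneg hnηw hc₀
    have := hB₀.le
    positivity
  -- STEP 2: `𝔇(H′(C′K′), H(CK))`
  have step2 := idef_comp_majorant (b₁ := BlockNorm.ofBlocks g blkη) (b₂ := BlockNorm.ofBlocks g blkΩ)
    (b₂' := BlockNorm.ofBlocks g blkΩ) (b₃' := BlockNorm.ofBlocks g (blkη ∘ prV))
    (τ₁ := pull prV) (τ₂ := LinearMap.id) (τ₃ := pull prV) (T₁' := D') (T₂' := C' ∘ₗ K') (T₁ := D) (T₂ := C ∘ₗ K)
    (w := fun _ => (1 : ℝ)) (σ := 0) (C := 1)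
    htri hρ (fun _ => zero_le_one) (slowWeight_const 1) zero_le_one hεCK haCK
    (fun y y' => mul_nonneg (Nat.cast_nonneg _) (mul_nonneg hcD (Real.exp_nonneg _))) hH'wrow
    (fun y y' => mul_nonneg (Nat.cast_nonneg _) (mul_nonneg hRD0 (Real.exp_nonneg _))) hDH_wrow
    hH'maj step1 hDH hCK
  refine step2.mono fun y y' => le_of_eq ?_
  simp only [hκ]
  ring



end Piece

end Summit.QuantumFields.YangMills.BalabanUVNodes.N15.VectorPiece
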